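import Mathlib
import HarnessLib
import Summits.Ventures.LatticeQCDFlow.Exactness.IMHMultiProposalStickingFloor

/-!
# The equilibrium renewal identity of the multi-proposal (ensemble) flow sampler: at stationarity the pool re-selects the CURRENT
# configuration with probability exactly `(1 + n·D)/(n + 1)`, `D = ½·E_{q^{⊗(n+1)}}[(w(z₀) − w(z₁))²/Σ_i w(z_i)]` — `1/(n + 1)` for a perfect
# flow, more by the weight-mismatch functional `D` otherwise

HONEST FRAMING: exact (Metropolis-corrected) sampling algorithms for lattice gauge theory;
figures of merit are autocorrelation/cost numbers at stated couplings and volumes; no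
continuum-physics claim.

Venture `LatticeQCDFlow` (cell pub-lqcd), topic `Exactness`; FANOUT row 30 (lean-1, GEN-42).  NEW WORK of the cell, general measurable state
space, over Mathlib (product measures, `measurePreserving_piCongrLeft`, Bochner integrals) and the tree's multi-proposal files
(`IMHMultiProposalExact`: `piCongrLeft_apply_eq`, `lintegral_pi_succ_eq_lintegral_cons`; `IMHMultiProposalMinorisation`:
`integral_coord_weight_eq`; `IMHMultiProposalStickingFloor`: the current state's pool term bounds `P(x, {x})` from below).

## Setting
Flow law `q`, normalised positive weight `w` (`∫ w dq = 1`, `π = w·q`), `n = m + 1 ≥ 1` fresh proposals per update; the pool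
`z = (z₀, z₁, …, z_n) ∼ q^{⊗(n+1)}` with `z₀` playing the current configuration (under `π = w·q` it is an independent `q`-draw weighted by
`w(z₀)`), pool weight `W(z) = Σ_i w(z_i)`.  The equilibrium selection probabilities are the Bochner integrals
`r = ∫ w(z₀)·w(z₀)/W dq^{⊗(n+1)}` (index `0` = STAY) and `s_j = ∫ w(z₀)·w(z_j)/W dq^{⊗(n+1)}` (index `j` = move to proposal `j`).

## Results (no `sorry`, no new definitions)
* §1 bookkeeping: integrability of the pool terms (`integrable_coord_weight`, `integrable_poolSelect_term`, `integrable_sqDiff_div_poolWeight`),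
  invariance of Bochner integrals under coordinate permutations (`integral_piCongrLeft_eq`), `sum_weight_perm`.
* §2 **`poolSelect_sum_eq_one`** — `Σ_j s_j = 1` (`s₀ = r`); **`poolSelect_symm`** — `s_j = s₁` for every `j ≠ 0` (a permutation fixing `0`);
  **`two_mul_poolStay_sub`** — `2(r − s₁) = ∫ (w(z₀) − w(z₁))²/W dq^{⊗(n+1)}` (swap `0 ↔ 1` gives `∫ w(z₁)²/W = r`, then expand the square):
  THE STAY PROBABILITY EXCEEDS EACH MOVE PROBABILITY BY THE WEIGHT-MISMATCH FUNCTIONAL.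
* §3 **`poolStay_eq`** — `r = (1 + n·D)/(n + 1)` and **`poolMove_eq`** — `Σ_{j ≥ 1} s_j = n(1 − D)/(n + 1)` with `D = ½∫(w(z₀) − w(z₁))²/W`;
  `poolStay_ge` — `r ≥ 1/(n + 1)` (equality iff `D = 0`, i.e. the weight is `q ⊗ q`-a.e. constant on pairs: a perfect flow);
  `mismatch_le_integral_abs_sub_one` — `D ≤ ∫ |w − 1| dq` (`= 2·TV(π, q)`), hence **`poolMove_ge_of_tv`** — the equilibrium renewal probability is
  at least `n(1 − ∫|w − 1| dq)/(n + 1)`, whatever `n`.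
* §4 **`multiProposal_stationary_holding_ge`** — for the pool-selection kernel `P` (def-free, `IMHMultiProposalExact`'s equation), the stationary
  holding probability `∫ P(x, {x}) π(dx)` is at least `r = (1 + n·D)/(n + 1)` (equality when `q` has no atoms; only `≥` is claimed).
Reading (gauge files): at equilibrium an ensemble gauge sampler that proposes `n` configurations per update keeps the current one with probability
`(1 + nD)/(n + 1)`: the batch cannot push the renewal rate above `n/(n + 1)`, and the deficit is an explicit quadratic mismatch between the
flow's weights on independent pairs, damped by the pool weight.  NOT CLAIMED: the `n → ∞` asymptotics `D ≈ χ²/(n + 1)` (only the `n`-free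
bound `D ≤ 2·TV`), anything away from equilibrium (see `IMHMultiProposalStickingFloor`).
-/

noncomputable section

namespace Summit.Ventures.LatticeQCDFlow.Exactness

open MeasureTheory ProbabilityTheory Function Finset
open scoped ENNReal

variable {Ω : Type*} [MeasurableSpace Ω] {q : Measure Ω} [IsProbabilityMeasure q] {w : Ω → ℝ} {m : ℕ}

/-! ## §1 Bookkeeping on `q^{⊗(m+2)}` -/

/-- Each coordinate weight `z ↦ w(z_i)` is integrable under the product law when `w` is. [ours, bookkeeping] -/
theorem integrable_coord_weight (hw : Measurable w) (hwi : Integrable w q) (i : Fin (m + 2)) :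
    Integrable (fun z : Fin (m + 2) → Ω => w (z i)) (Measure.pi fun _ : Fin (m + 2) => q) :=
  ((measurePreserving_eval (fun _ : Fin (m + 2) => q) i).integrable_comp hw.aestronglyMeasurable).2 hwi

omit [MeasurableSpace Ω] in
/-- The pool weight is positive. [ours, bookkeeping] -/
theorem poolWeight_pos (hw0 : ∀ y, 0 < w y) (z : Fin (m + 2) → Ω) : 0 < ∑ i, w (z i) :=
  sum_pos (fun _ _ => hw0 _) univ_nonempty

omit [MeasurableSpace Ω] in
/-- A single weight is at most the pool weight. [ours, bookkeeping] -/
theorem weight_le_poolWeight (hw0 : ∀ y, 0 < w y) (z : Fin (m + 2) → Ω) (j : Fin (m + 2)) : w (z j) ≤ ∑ i, w (z i) :=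
  single_le_sum (fun i _ => (hw0 (z i)).le) (mem_univ j)

/-- Measurability of the pool weight. [ours, bookkeeping] -/
theorem measurable_poolWeight (hw : Measurable w) : Measurable fun z : Fin (m + 2) → Ω => ∑ i, w (z i) :=
  Finset.measurable_sum _ fun i _ => hw.comp (measurable_pi_apply i)

/-- The selection term `w(z₀)·w(z_j)/W(z)` is integrable (it is dominated by `w(z₀)`). [ours, bookkeeping] -/
theorem integrable_poolSelect_term (hw : Measurable w) (hw0 : ∀ y, 0 < w y) (hwi : Integrable w q) (j : Fin (m + 2)) :
    Integrable (fun z : Fin (m + 2) → Ω => w (z 0) * (w (z j) / ∑ i, w (z i))) (Measure.pi fun _ : Fin (m + 2) => q) := by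
  refine Integrable.mono' (integrable_coord_weight hw hwi 0)
    (((hw.comp (measurable_pi_apply 0)).mul ((hw.comp (measurable_pi_apply j)).div (measurable_poolWeight hw))).aestronglyMeasurable)
    (ae_of_all _ fun z => ?_)
  have hW := poolWeight_pos hw0 z
  rw [Real.norm_eq_abs, abs_of_nonneg (mul_nonneg (hw0 _).le (div_nonneg (hw0 _).le hW.le))]
  calc w (z 0) * (w (z j) / ∑ i, w (z i)) ≤ w (z 0) * 1 :=
        mul_le_mul_of_nonneg_left ((div_le_one hW).2 (weight_le_poolWeight hw0 z j)) (hw0 _).le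
    _ = w (z 0) := mul_one _

/-- The mismatch term `(w(z₀) − w(z₁))²/W(z)` is integrable (it is dominated by `w(z₀) + w(z₁)`). [ours, bookkeeping] -/
theorem integrable_sqDiff_div_poolWeight (hw : Measurable w) (hw0 : ∀ y, 0 < w y) (hwi : Integrable w q) :
    Integrable (fun z : Fin (m + 2) → Ω => (w (z 0) - w (z 1)) ^ 2 / ∑ i, w (z i)) (Measure.pi fun _ : Fin (m + 2) => q) := by
  refine Integrable.mono' ((integrable_coord_weight hw hwi 0).add (integrable_coord_weight hw hwi 1))
    ((((hw.comp (measurable_pi_apply 0)).sub (hw.comp (measurable_pi_apply 1))).pow_const 2).div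
      (measurable_poolWeight hw)).aestronglyMeasurable (ae_of_all _ fun z => ?_)
  have hW := poolWeight_pos hw0 z
  have h01 : w (z 0) + w (z 1) ≤ ∑ i, w (z i) := by
    rw [Fin.sum_univ_succ, Fin.sum_univ_succ]
    exact add_le_add le_rfl (le_add_of_nonneg_right (sum_nonneg fun i _ => (hw0 _).le))
  rw [Real.norm_eq_abs, abs_of_nonneg (div_nonneg (sq_nonneg _) hW.le), div_le_iff₀ hW]
  simp only [Pi.add_apply]
  have h0 := hw0 (z 0); have h1 := hw0 (z 1)
  calc (w (z 0) - w (z 1)) ^ 2 ≤ (w (z 0) + w (z 1)) ^ 2 := by nlinarith [mul_pos h0 h1]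
    _ = (w (z 0) + w (z 1)) * (w (z 0) + w (z 1)) := sq _
    _ ≤ (w (z 0) + w (z 1)) * ∑ i, w (z i) := mul_le_mul_of_nonneg_left h01 (add_nonneg h0.le h1.le)

omit [MeasurableSpace Ω] in
/-- The pool weight (real) is invariant under coordinate permutations. [ours, bookkeeping] -/
theorem sum_weight_perm [MeasurableSpace Ω] (σ : Equiv.Perm (Fin (m + 2))) (z : Fin (m + 2) → Ω) :
    ∑ i, w ((MeasurableEquiv.piCongrLeft (fun _ : Fin (m + 2) => Ω) σ) z i) = ∑ i, w (z i) := by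
  simp_rw [piCongrLeft_apply_eq]
  exact Equiv.sum_comp σ.symm (fun i => w (z i))

/-- Bochner integrals over `q^{⊗(m+2)}` are invariant under coordinate permutations. [ours, bookkeeping] -/
theorem integral_piCongrLeft_eq (σ : Equiv.Perm (Fin (m + 2))) (F : (Fin (m + 2) → Ω) → ℝ) :
    ∫ z, F ((MeasurableEquiv.piCongrLeft (fun _ : Fin (m + 2) => Ω) σ) z) ∂(Measure.pi fun _ : Fin (m + 2) => q) =
      ∫ z, F z ∂(Measure.pi fun _ : Fin (m + 2) => q) :=
  (measurePreserving_piCongrLeft (fun _ : Fin (m + 2) => q) σ).integral_comp' F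

/-! ## §2 The three identities -/

/-- **`Σ_j s_j = 1`**: the equilibrium selection probabilities over the whole pool add up to `∫ w(z₀) dq^{⊗(n+1)} = ∫ w dq = 1`. [ours] -/
theorem poolSelect_sum_eq_one (hw : Measurable w) (hw0 : ∀ y, 0 < w y) (h1 : ∫ y, w y ∂q = 1) :
    ∑ j : Fin (m + 2), ∫ z, w (z 0) * (w (z j) / ∑ i, w (z i)) ∂(Measure.pi fun _ : Fin (m + 2) => q) = 1 := by
  have hwi : Integrable w q := by
    by_contra h; rw [integral_undef h] at h1; exact zero_ne_one h1
  rw [← integral_finsetSum _ fun j _ => integrable_poolSelect_term hw hw0 hwi j]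
  have hpt : ∀ z : Fin (m + 2) → Ω, ∑ j, w (z 0) * (w (z j) / ∑ i, w (z i)) = w (z 0) := fun z => by
    rw [← mul_sum, ← sum_div, div_self (poolWeight_pos hw0 z).ne', mul_one]
  simp_rw [hpt]
  rw [integral_coord_weight_eq hw, h1]

/-- **`s_j = s₁` for every proposal index `j ≠ 0`**: the transposition of coordinates `1` and `j` fixes `z₀`, the pool weight and the product
law. [ours] -/
theorem poolSelect_symm (hw : Measurable w) {j : Fin (m + 2)} (hj : j ≠ 0) :
    ∫ z, w (z 0) * (w (z j) / ∑ i, w (z i)) ∂(Measure.pi fun _ : Fin (m + 2) => q) =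
      ∫ z, w (z 0) * (w (z 1) / ∑ i, w (z i)) ∂(Measure.pi fun _ : Fin (m + 2) => q) := by
  have _ := hw
  set σ : Equiv.Perm (Fin (m + 2)) := Equiv.swap 1 j with hσ
  rw [← integral_piCongrLeft_eq (q := q) σ (fun z => w (z 0) * (w (z 1) / ∑ i, w (z i)))]
  refine integral_congr_ae (ae_of_all _ fun z => ?_)
  have h0 : (MeasurableEquiv.piCongrLeft (fun _ : Fin (m + 2) => Ω) σ) z 0 = z 0 := by
    rw [piCongrLeft_apply_eq, hσ, Equiv.symm_swap, Equiv.swap_apply_of_ne_of_ne (zero_ne_one : (0 : Fin (m + 2)) ≠ 1) hj.symm]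
  have h1 : (MeasurableEquiv.piCongrLeft (fun _ : Fin (m + 2) => Ω) σ) z 1 = z j := by
    rw [piCongrLeft_apply_eq, hσ, Equiv.symm_swap, Equiv.swap_apply_left]
  simp only [h0, h1, sum_weight_perm]

/-- Swap `0 ↔ 1`: `∫ w(z₁)²/W = ∫ w(z₀)²/W (= r)`. [ours, bookkeeping] -/
theorem poolStay_swap (hw : Measurable w) :
    ∫ z, w (z 1) * (w (z 1) / ∑ i, w (z i)) ∂(Measure.pi fun _ : Fin (m + 2) => q) =
      ∫ z, w (z 0) * (w (z 0) / ∑ i, w (z i)) ∂(Measure.pi fun _ : Fin (m + 2) => q) := by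
  have _ := hw
  set σ : Equiv.Perm (Fin (m + 2)) := Equiv.swap 0 1 with hσ
  rw [← integral_piCongrLeft_eq (q := q) σ (fun z => w (z 0) * (w (z 0) / ∑ i, w (z i)))]
  refine integral_congr_ae (ae_of_all _ fun z => ?_)
  have h0 : (MeasurableEquiv.piCongrLeft (fun _ : Fin (m + 2) => Ω) σ) z 0 = z 1 := by
    rw [piCongrLeft_apply_eq, hσ, Equiv.symm_swap, Equiv.swap_apply_left]
  simp only [h0, sum_weight_perm]

/-- **THE MISMATCH IDENTITY: `2(r − s₁) = ∫ (w(z₀) − w(z₁))²/W dq^{⊗(n+1)}`** — the stay probability exceeds each move probability by half the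
pool-damped quadratic mismatch of the weights on an independent pair. [ours] -/
theorem two_mul_poolStay_sub (hw : Measurable w) (hw0 : ∀ y, 0 < w y) (hwi : Integrable w q) :
    2 * (∫ z, w (z 0) * (w (z 0) / ∑ i, w (z i)) ∂(Measure.pi fun _ : Fin (m + 2) => q) -
        ∫ z, w (z 0) * (w (z 1) / ∑ i, w (z i)) ∂(Measure.pi fun _ : Fin (m + 2) => q)) =
      ∫ z, (w (z 0) - w (z 1)) ^ 2 / ∑ i, w (z i) ∂(Measure.pi fun _ : Fin (m + 2) => q) := by
  set μ : Measure (Fin (m + 2) → Ω) := Measure.pi fun _ : Fin (m + 2) => q with hμ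
  have hr' := poolStay_swap (q := q) (m := m) hw
  have hi0 := integrable_poolSelect_term (m := m) hw hw0 hwi 0
  have hi1 := integrable_poolSelect_term (m := m) hw hw0 hwi 1
  have hi1' : Integrable (fun z : Fin (m + 2) → Ω => w (z 1) * (w (z 1) / ∑ i, w (z i))) μ := by
    have h := (measurePreserving_piCongrLeft (fun _ : Fin (m + 2) => q) (Equiv.swap 0 1)).integrable_comp_emb
      (MeasurableEquiv.measurableEmbedding _) (g := fun z : Fin (m + 2) → Ω => w (z 0) * (w (z 0) / ∑ i, w (z i)))
    have h2 := h.2 hi0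
    refine h2.congr (ae_of_all _ fun z => ?_)
    have h0 : (MeasurableEquiv.piCongrLeft (fun _ : Fin (m + 2) => Ω) (Equiv.swap 0 1)) z 0 = z 1 := by
      rw [piCongrLeft_apply_eq, Equiv.symm_swap, Equiv.swap_apply_left]
    simp only [Function.comp, h0, sum_weight_perm]
  have hpt : ∀ z : Fin (m + 2) → Ω, (w (z 0) - w (z 1)) ^ 2 / ∑ i, w (z i) =
      w (z 0) * (w (z 0) / ∑ i, w (z i)) + w (z 1) * (w (z 1) / ∑ i, w (z i)) - 2 * (w (z 0) * (w (z 1) / ∑ i, w (z i))) := fun z => by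
    have hW := (poolWeight_pos hw0 z).ne'
    field_simp
    ring
  simp_rw [hpt]
  rw [integral_sub ?_ ?_, integral_add hi0 hi1', integral_const_mul, hr']
  · ring
  · exact hi0.add hi1'
  · exact hi1.const_mul 2

/-! ## §3 Solving for the stay and move probabilities -/

/-- **THE STAY PROBABILITY: `r = (1 + n·D)/(n + 1)`**, `n = m + 1` proposals, `D = ½∫(w(z₀) − w(z₁))²/W dq^{⊗(n+1)}`. [ours] -/
theorem poolStay_eq (hw : Measurable w) (hw0 : ∀ y, 0 < w y) (h1 : ∫ y, w y ∂q = 1) :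
    ∫ z, w (z 0) * (w (z 0) / ∑ i, w (z i)) ∂(Measure.pi fun _ : Fin (m + 2) => q) =
      (1 + (m + 1 : ℝ) * ((∫ z, (w (z 0) - w (z 1)) ^ 2 / ∑ i, w (z i) ∂(Measure.pi fun _ : Fin (m + 2) => q)) / 2)) / (m + 2) := by
  have hwi : Integrable w q := by
    by_contra h; rw [integral_undef h] at h1; exact zero_ne_one h1
  have hsum := poolSelect_sum_eq_one (m := m) hw hw0 h1
  have hD := two_mul_poolStay_sub (m := m) hw hw0 hwi
  rw [Fin.sum_univ_succ] at hsum
  have hs : ∀ i : Fin (m + 1), ∫ z, w (z 0) * (w (z i.succ) / ∑ k, w (z k)) ∂(Measure.pi fun _ : Fin (m + 2) => q) =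
      ∫ z, w (z 0) * (w (z 1) / ∑ k, w (z k)) ∂(Measure.pi fun _ : Fin (m + 2) => q) := fun i =>
    poolSelect_symm hw (Fin.succ_ne_zero i)
  simp_rw [hs] at hsum
  rw [sum_const, card_univ, Fintype.card_fin, nsmul_eq_mul] at hsum
  set r := ∫ z, w (z 0) * (w (z 0) / ∑ i, w (z i)) ∂(Measure.pi fun _ : Fin (m + 2) => q)
  set s := ∫ z, w (z 0) * (w (z 1) / ∑ i, w (z i)) ∂(Measure.pi fun _ : Fin (m + 2) => q)
  set Δ := ∫ z, (w (z 0) - w (z 1)) ^ 2 / ∑ i, w (z i) ∂(Measure.pi fun _ : Fin (m + 2) => q)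
  have hm : (0 : ℝ) < m + 2 := by positivity
  push_cast at hsum
  rw [eq_div_iff hm.ne']
  linear_combination hsum + ((m : ℝ) + 1) / 2 * hD

/-- **THE MOVE (RENEWAL) PROBABILITY: `Σ_{j ≥ 1} s_j = n(1 − D)/(n + 1)`** at equilibrium. [ours] -/
theorem poolMove_eq (hw : Measurable w) (hw0 : ∀ y, 0 < w y) (h1 : ∫ y, w y ∂q = 1) :
    ∑ j : Fin (m + 1), ∫ z, w (z 0) * (w (z j.succ) / ∑ i, w (z i)) ∂(Measure.pi fun _ : Fin (m + 2) => q) =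
      (m + 1 : ℝ) * (1 - (∫ z, (w (z 0) - w (z 1)) ^ 2 / ∑ i, w (z i) ∂(Measure.pi fun _ : Fin (m + 2) => q)) / 2) / (m + 2) := by
  have hsum := poolSelect_sum_eq_one (m := m) hw hw0 h1
  rw [Fin.sum_univ_succ, poolStay_eq hw hw0 h1] at hsum
  have hm : (0 : ℝ) < m + 2 := by positivity
  set M := ∑ j : Fin (m + 1), ∫ z, w (z 0) * (w (z j.succ) / ∑ i, w (z i)) ∂(Measure.pi fun _ : Fin (m + 2) => q)
  set Δ := ∫ z, (w (z 0) - w (z 1)) ^ 2 / ∑ i, w (z i) ∂(Measure.pi fun _ : Fin (m + 2) => q)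
  have key : M = 1 - (1 + (m + 1 : ℝ) * (Δ / 2)) / (m + 2) := by linarith
  rw [key]
  field_simp
  ring

omit [IsProbabilityMeasure q] in
/-- The mismatch functional is nonnegative. [ours, bookkeeping] -/
theorem mismatch_nonneg (hw0 : ∀ y, 0 < w y) :
    0 ≤ ∫ z, (w (z 0) - w (z 1)) ^ 2 / ∑ i, w (z i) ∂(Measure.pi fun _ : Fin (m + 2) => q) :=
  integral_nonneg fun z => div_nonneg (sq_nonneg _) (poolWeight_pos hw0 z).le

/-- **`r ≥ 1/(n + 1)`**: at equilibrium the ensemble sampler keeps the current configuration at least as often as a perfect flow would, with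
equality iff `D = 0`. [ours] -/
theorem poolStay_ge (hw : Measurable w) (hw0 : ∀ y, 0 < w y) (h1 : ∫ y, w y ∂q = 1) :
    1 / ((m : ℝ) + 2) ≤ ∫ z, w (z 0) * (w (z 0) / ∑ i, w (z i)) ∂(Measure.pi fun _ : Fin (m + 2) => q) := by
  rw [poolStay_eq hw hw0 h1]
  have hm : (0 : ℝ) < m + 2 := by positivity
  have hD := mismatch_nonneg (q := q) (m := m) hw0
  exact div_le_div_of_nonneg_right (le_add_of_nonneg_right (mul_nonneg (by positivity) (div_nonneg hD zero_le_two))) hm.le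

/-- **`D ≤ ∫ |w − 1| dq`** (`= 2·TV(π, q)`): pointwise `(a − b)²/W ≤ (a − b)²/(a + b) ≤ |a − b| ≤ |a − 1| + |b − 1|`. [ours] -/
theorem mismatch_le_integral_abs_sub_one (hw : Measurable w) (hw0 : ∀ y, 0 < w y) (hwi : Integrable w q) :
    (∫ z, (w (z 0) - w (z 1)) ^ 2 / ∑ i, w (z i) ∂(Measure.pi fun _ : Fin (m + 2) => q)) / 2 ≤ ∫ y, |w y - 1| ∂q := by
  set μ : Measure (Fin (m + 2) → Ω) := Measure.pi fun _ : Fin (m + 2) => q with hμ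
  have habs : Integrable (fun y => |w y - 1|) q := (hwi.sub (integrable_const 1)).abs
  have hc0 : ∫ z, |w (z 0) - 1| ∂μ = ∫ y, |w y - 1| ∂q :=
    integral_coord_weight_eq (q := q) (m := m + 2) (w := fun y => |w y - 1|) ((hw.sub measurable_const).abs) 0
  have hc1 : ∫ z, |w (z 1) - 1| ∂μ = ∫ y, |w y - 1| ∂q :=
    integral_coord_weight_eq (q := q) (m := m + 2) (w := fun y => |w y - 1|) ((hw.sub measurable_const).abs) 1
  have hi0 : Integrable (fun z : Fin (m + 2) → Ω => |w (z 0) - 1|) μ :=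
    ((measurePreserving_eval (fun _ : Fin (m + 2) => q) 0).integrable_comp habs.aestronglyMeasurable).2 habs
  have hi1 : Integrable (fun z : Fin (m + 2) → Ω => |w (z 1) - 1|) μ :=
    ((measurePreserving_eval (fun _ : Fin (m + 2) => q) 1).integrable_comp habs.aestronglyMeasurable).2 habs
  have hle : ∫ z, (w (z 0) - w (z 1)) ^ 2 / ∑ i, w (z i) ∂μ ≤ ∫ z, (|w (z 0) - 1| + |w (z 1) - 1|) ∂μ := by
    refine integral_mono (integrable_sqDiff_div_poolWeight hw hw0 hwi) (hi0.add hi1) fun z => ?_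
    have hW := poolWeight_pos hw0 z
    have h01 : w (z 0) + w (z 1) ≤ ∑ i, w (z i) := by
      rw [Fin.sum_univ_succ, Fin.sum_univ_succ]
      exact add_le_add le_rfl (le_add_of_nonneg_right (sum_nonneg fun i _ => (hw0 _).le))
    have ha := hw0 (z 0); have hb := hw0 (z 1)
    have hab : |w (z 0) - w (z 1)| ≤ |w (z 0) - 1| + |w (z 1) - 1| := by
      calc |w (z 0) - w (z 1)| = |(w (z 0) - 1) - (w (z 1) - 1)| := by ring_nf
        _ ≤ |w (z 0) - 1| + |w (z 1) - 1| := abs_sub _ _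
    calc (w (z 0) - w (z 1)) ^ 2 / ∑ i, w (z i) ≤ (w (z 0) - w (z 1)) ^ 2 / (w (z 0) + w (z 1)) :=
          div_le_div_of_nonneg_left (sq_nonneg _) (add_pos ha hb) h01
      _ ≤ |w (z 0) - w (z 1)| := by
          rw [div_le_iff₀ (add_pos ha hb), ← sq_abs]
          have h3 : |w (z 0) - w (z 1)| ≤ w (z 0) + w (z 1) := by
            rw [abs_sub_le_iff]; constructor <;> linarith
          calc |w (z 0) - w (z 1)| ^ 2 = |w (z 0) - w (z 1)| * |w (z 0) - w (z 1)| := sq _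
            _ ≤ |w (z 0) - w (z 1)| * (w (z 0) + w (z 1)) := mul_le_mul_of_nonneg_left h3 (abs_nonneg _)
      _ ≤ |w (z 0) - 1| + |w (z 1) - 1| := hab
  rw [integral_add hi0 hi1, hc0, hc1] at hle
  linarith

/-- **THE RENEWAL FLOOR AT EQUILIBRIUM: `Σ_{j ≥ 1} s_j ≥ n(1 − ∫|w − 1| dq)/(n + 1)`** — a flow within total variation `ε` of the target
renews at equilibrium with probability at least `n(1 − 2ε)/(n + 1)`. [ours] -/
theorem poolMove_ge_of_tv (hw : Measurable w) (hw0 : ∀ y, 0 < w y) (h1 : ∫ y, w y ∂q = 1) :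
    (m + 1 : ℝ) * (1 - ∫ y, |w y - 1| ∂q) / (m + 2) ≤
      ∑ j : Fin (m + 1), ∫ z, w (z 0) * (w (z j.succ) / ∑ i, w (z i)) ∂(Measure.pi fun _ : Fin (m + 2) => q) := by
  have hwi : Integrable w q := by
    by_contra h; rw [integral_undef h] at h1; exact zero_ne_one h1
  rw [poolMove_eq hw hw0 h1]
  have hm : (0 : ℝ) < m + 2 := by positivity
  have hD := mismatch_le_integral_abs_sub_one (m := m) hw hw0 hwi
  refine div_le_div_of_nonneg_right (mul_le_mul_of_nonneg_left (by linarith) (by positivity)) hm.le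

/-! ## §4 The stationary holding probability of the pool-selection kernel -/

/-- **THE STATIONARY HOLDING PROBABILITY IS AT LEAST `r = (1 + n·D)/(n + 1)`**: for the pool-selection kernel with `n = m + 1` fresh
proposals, `∫ P(x, {x}) π(dx) ≥ ∫ w(z₀)²/W dq^{⊗(n+1)}` (the current state's own selection term; proposals coinciding with `x` can only add).
[ours] -/
theorem multiProposal_stationary_holding_ge [MeasurableSingletonClass Ω] (hw : Measurable w) (hw0 : ∀ y, 0 < w y) (h1 : ∫ y, w y ∂q = 1)
    (P : Kernel Ω Ω)
    (hP : ∀ (x : Ω) {B : Set Ω}, MeasurableSet B → P x B = ∫⁻ y, (∑ j, ENNReal.ofReal (w (Fin.cons (α := fun _ : Fin (m + 2) => Ω) x y j)) *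
      B.indicator (fun _ => (1 : ℝ≥0∞)) (Fin.cons (α := fun _ : Fin (m + 2) => Ω) x y j)) /
      (∑ i, ENNReal.ofReal (w (Fin.cons (α := fun _ : Fin (m + 2) => Ω) x y i))) ∂(Measure.pi fun _ : Fin (m + 1) => q)) :
    ENNReal.ofReal ((1 + (m + 1 : ℝ) * ((∫ z, (w (z 0) - w (z 1)) ^ 2 / ∑ i, w (z i) ∂(Measure.pi fun _ : Fin (m + 2) => q)) / 2)) / (m + 2))
      ≤ ∫⁻ x, P x {x} ∂(q.withDensity fun y => ENNReal.ofReal (w y)) := by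
  have hwi : Integrable w q := by
    by_contra h; rw [integral_undef h] at h1; exact zero_ne_one h1
  rw [← poolStay_eq hw hw0 h1]
  -- the real stay probability as a `lintegral` over the pool
  have hF : Measurable fun z : Fin (m + 2) → Ω => ENNReal.ofReal (w (z 0)) *
      (ENNReal.ofReal (w (z 0)) / ∑ i, ENNReal.ofReal (w (z i))) :=
    (hw.ennreal_ofReal.comp (measurable_pi_apply 0)).mul ((hw.ennreal_ofReal.comp (measurable_pi_apply 0)).div
      (Finset.measurable_sum _ fun i _ => hw.ennreal_ofReal.comp (measurable_pi_apply i)))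
  have hpt : ∀ z : Fin (m + 2) → Ω, ENNReal.ofReal (w (z 0)) * (ENNReal.ofReal (w (z 0)) / ∑ i, ENNReal.ofReal (w (z i))) =
      ENNReal.ofReal (w (z 0) * (w (z 0) / ∑ i, w (z i))) := fun z => by
    rw [← ENNReal.ofReal_sum_of_nonneg (fun i _ => (hw0 _).le), ← ENNReal.ofReal_div_of_pos (poolWeight_pos hw0 z),
      ← ENNReal.ofReal_mul (hw0 _).le]
  have hreal : ENNReal.ofReal (∫ z, w (z 0) * (w (z 0) / ∑ i, w (z i)) ∂(Measure.pi fun _ : Fin (m + 2) => q)) =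
      ∫⁻ z, ENNReal.ofReal (w (z 0)) * (ENNReal.ofReal (w (z 0)) / ∑ i, ENNReal.ofReal (w (z i))) ∂(Measure.pi fun _ : Fin (m + 2) => q) := by
    simp_rw [hpt]
    rw [ofReal_integral_eq_lintegral_ofReal (integrable_poolSelect_term hw hw0 hwi 0)
      (ae_of_all _ fun z => mul_nonneg (hw0 _).le (div_nonneg (hw0 _).le (poolWeight_pos hw0 z).le))]
  rw [hreal, lintegral_pi_succ_eq_lintegral_cons q (m + 1) hF]
  simp only [Fin.cons_zero]
  -- against `π = w·q` (the integrand `x ↦ P(x, {x})` need not be measurable: the non-measurable form of the density rule)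
  rw [lintegral_withDensity_eq_lintegral_mul_non_measurable q hw.ennreal_ofReal (ae_of_all _ fun x => ENNReal.ofReal_lt_top)
    (fun x => P x {x})]
  refine lintegral_mono fun x => ?_
  simp only [Pi.mul_apply]
  rw [lintegral_const_mul' _ _ ENNReal.ofReal_ne_top]
  refine mul_le_mul' le_rfl ?_
  have h := multiProposal_apply_self_ge_lintegral (q := q) (n := m + 1) hw0 P hP x (measurableSet_singleton x)
  refine le_trans (le_of_eq ?_) h
  refine lintegral_congr fun y => ?_
  rw [Fin.sum_univ_succ]
  simp only [Fin.cons_zero, Fin.cons_succ]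

end Summit.Ventures.LatticeQCDFlow.Exactness
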